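import Summits.BirchSwinnertonDyer.Rank1Residual.X12.O11.RouteUPrimeMember
import Summits.BirchSwinnertonDyer.Rank1Residual.X12.O11.RouteUBernoulliD11
import HarnessLib

/-!
# ROUTE U, prime member `D = −67` (curve `219961e1`, `N = 49·67² = 219961`), Heegner field
# `K'' = ℚ(√−31)`: the two Bernoulli-unit certificates, BSD₇ and FULL BSD by the prime-member class theorem

bsd-cm cell (run/shared/lean/pub/bsd-cm/), ROUTE U, seat `bsd-cm-ram`. Instance of
`RouteU.bsdp_seven_of_twist_cm7_prime` at `(q, r) = (67, 31)`: `67 ≡ 31 ≡ 3 (mod 4)`,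
`(−31/7) = (−31/67) = 1`. The per-member inputs are the two kernel certificates (`decide +kernel`,
mod-`49` sums of lengths `469` and `14539`, the second in 10 blocks of ≤ 1500 terms):
* `norm_generalizedBernoulli_theta1_D67` — `‖B_{1,ω⁴χ_{−67}}‖₇ = 1` (`S₁ = Σ_{j<469} (j/67)·j²⁹`, `7 ∥ S₁`);
* `norm_generalizedBernoulli_theta2_D67` — `‖B_{1,ωχ_{−67}χ_{−31}}‖₇ = 1` (`S₂ = Σ_{j<14539} (j/67)(j/31)·j⁸`, `7 ∥ S₂`);
* **`bsdp_seven_of_twist_cm7_D67`** — BSD₇ for every globally minimal model of `49a1^{(−67)}` with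
  `r_an = 1`, from the class theorem (named facts: Kriz–Li Thm 1.20 / Rem 3.10, Gross–Zagier, Kolyvagin,
  GZK, modularity, Rubin 1983 Thm C, Burungale–Flach 2024, Buhler–Gross 1985 Ch. II; displayed data:
  Heegner datum over `ℚ(√−31)`, a Mordell–Weil coordinate over `K`, `L(W^{(−31)},1) ≠ 0`, the twin's
  minimal model, `7 ∤ c` (Manin constant — displayed hypothesis `hc7`; LABEL OF RECORD, planner ruling D62: DATA =
  Cremona ecdata opt_man, curve 1 certainly optimal, `c = 1`; CERTIFIED-DATUM pending lit W38 engine B; NOT print));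
  the descent inputs (no `7`-torsion over `K`, `7 ∤ #Ш(W)`)
  are discharged inside the class theorem;
* `forall_bsdp_of_twist_cm7_D67` — FULL BSD (Miller's `BSD(E,p)` at every prime), `W ∈ 𝒞₇` since `(−7/67) = 1`.
THEOREMS ONLY; nothing booked. References: [KrizLi2019] Thm. 1.20; [Washington1997] §5.1, Thm 4.2;
[Rubin1983] Thm C; [BuhlerGross1985] Ch. II; [BurungaleFlach2024] Thm 1.1; [Miller2011LMS] Def. 1.1.
-/

noncomputable section

open scoped Classical
open NumberField WeierstrassCurve DirichletCharacter
open Literature.NumberTheory.EllipticCurves Literature.NumberTheory.EllipticCurves.Rank1Residual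
open Literature.NumberTheory.EllipticCurves.KrizLi2019 Literature.NumberTheory.LFunctions
open Literature.NumberTheory.EllipticCurves.ModularForms

namespace Summit.BirchSwinnertonDyer.Rank1Residual.X12.O11.RouteU

/-- `67` is prime (a `Prop`-instance registered as a theorem). [folklore] -/
@[instance] theorem fact_prime_67_D67 : Fact (Nat.Prime 67) := ⟨by norm_num⟩

/-- `31` is prime (a `Prop`-instance registered as a theorem). [folklore] -/
@[instance] theorem fact_prime_31_D67 : Fact (Nat.Prime 31) := ⟨by norm_num⟩

/-- `ord₇ (7·67) = 1`. [folklore] -/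
theorem padicValNat_seven_level1_D67 : padicValNat 7 (7 * 67) = 1 := by
  rw [padicValNat.mul (by norm_num) (by norm_num), padicValNat_self, padicValNat.eq_zero_of_not_dvd (by norm_num)]

/-- `ord₇ (7·67·31) = 1`. [folklore] -/
theorem padicValNat_seven_level2_D67 : padicValNat 7 (7 * 67 * 31) = 1 := by
  rw [show (7 * 67 * 31 : ℕ) = 7 * (67 * 31) by ring, padicValNat.mul (by norm_num) (by norm_num),
    padicValNat_self, padicValNat.eq_zero_of_not_dvd (by norm_num)]

set_option maxRecDepth 400000 in
/-- **`‖B_{1,θ₁}‖₇ = 1`** for every character `θ₁` mod `7·67` with values `(j/67)·ω(j)⁴`, `ω`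
Teichmüller (certificate `7 ∥ Σ_{j<469} (j/67) j²⁹`, `decide +kernel`).
[cite: KrizLi2019, Thm. 1.20 (p. 8) and §1.5 (1)] [cite: Washington1997, §5.1 and Thm. 4.2] -/
theorem norm_generalizedBernoulli_theta1_D67 (ω : DirichletCharacter ℚ_[7] 7)
    (hω : IsTeichmullerCharacter ω) (θ : DirichletCharacter ℚ_[7] (7 * 67))
    (hθ : ∀ j : ZMod (7 * 67), θ j = (legendreSym 67 (j.val : ℤ) : ℚ_[7]) * ω (j.val : ZMod 7) ^ 4) :
    ‖generalizedBernoulli 1 θ‖ = 1 := by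
  have hθ1 : θ ≠ 1 := by
    intro h1
    have hv := hθ (((468 : ℕ)) : ZMod (7 * 67))
    have hval : (((468 : ℕ) : ZMod (7 * 67))).val = 468 := by
      rw [ZMod.val_natCast]
    have h6 : (((468 : ℕ)) : ZMod 7) = ((6 : ℕ) : ZMod 7) := by decide
    have hu : IsUnit (((468 : ℕ)) : ZMod (7 * 67)) := by
      rw [ZMod.isUnit_iff_coprime]; norm_num
    rw [h1, hval, MulChar.one_apply hu, h6, apply_neg_one_pow_four, mul_one] at hv
    have hL : legendreSym 67 ((468 : ℕ) : ℤ) = -1 := by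
      rw [legendreSym_eq_ite 67 (by norm_num)]; decide
    rw [hL] at hv
    norm_num at hv
  refine norm_generalizedBernoulli_one_eq_one_of_cert θ hθ1 padicValNat_seven_level1_D67
    (fun j => legendreSym 67 (j.val : ℤ)) 28 (fun j => ?_) ?_ ?_
  · have := norm_sub_le_of_values ω hω θ (fun m => legendreSym 67 (m : ℤ)) 4 (by norm_num) hθ j
    simpa using this
  · simp_rw [legendreSym_eq_ite 67 (by norm_num)]
    decide +kernel
  · simp_rw [legendreSym_eq_ite 67 (by norm_num)]
    decide +kernel

set_option maxRecDepth 400000 in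
/-- Block 0 of the `θ₂` certificate for `D = −67`: `Σ_{0 ≤ j < 1500} (j/67)(j/31) j⁸` evaluated (`decide +kernel`). [folklore] -/
theorem theta2_D67_block0 :
    ∑ j ∈ Finset.Ico (0 : ℕ) 1500, (legendreSym 67 (j : ℤ) * legendreSym 31 (j : ℤ)) * (j : ℤ) ^ (7 + 1) =
      147607354996391934778931463 := by
  simp_rw [legendreSym_eq_ite 67 (by norm_num), legendreSym_eq_ite 31 (by norm_num)]
  decide +kernel

set_option maxRecDepth 400000 in
/-- Block 1 of the `θ₂` certificate for `D = −67`: `Σ_{1500 ≤ j < 3000} (j/67)(j/31) j⁸` evaluated (`decide +kernel`). [folklore] -/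
theorem theta2_D67_block1 :
    ∑ j ∈ Finset.Ico (1500 : ℕ) 3000, (legendreSym 67 (j : ℤ) * legendreSym 31 (j : ℤ)) * (j : ℤ) ^ (7 + 1) =
      -5903722495454209562008038342 := by
  simp_rw [legendreSym_eq_ite 67 (by norm_num), legendreSym_eq_ite 31 (by norm_num)]
  decide +kernel

set_option maxRecDepth 400000 in
/-- Block 2 of the `θ₂` certificate for `D = −67`: `Σ_{3000 ≤ j < 4500} (j/67)(j/31) j⁸` evaluated (`decide +kernel`). [folklore] -/
theorem theta2_D67_block2 :
    ∑ j ∈ Finset.Ico (3000 : ℕ) 4500, (legendreSym 67 (j : ℤ) * legendreSym 31 (j : ℤ)) * (j : ℤ) ^ (7 + 1) =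
      181733259919006963494557758119 := by
  simp_rw [legendreSym_eq_ite 67 (by norm_num), legendreSym_eq_ite 31 (by norm_num)]
  decide +kernel

set_option maxRecDepth 400000 in
/-- Block 3 of the `θ₂` certificate for `D = −67`: `Σ_{4500 ≤ j < 6000} (j/67)(j/31) j⁸` evaluated (`decide +kernel`). [folklore] -/
theorem theta2_D67_block3 :
    ∑ j ∈ Finset.Ico (4500 : ℕ) 6000, (legendreSym 67 (j : ℤ) * legendreSym 31 (j : ℤ)) * (j : ℤ) ^ (7 + 1) =
      -20517312476738261253574980218797 := by
  simp_rw [legendreSym_eq_ite 67 (by norm_num), legendreSym_eq_ite 31 (by norm_num)]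
  decide +kernel

set_option maxRecDepth 400000 in
/-- Block 4 of the `θ₂` certificate for `D = −67`: `Σ_{6000 ≤ j < 7500} (j/67)(j/31) j⁸` evaluated (`decide +kernel`). [folklore] -/
theorem theta2_D67_block4 :
    ∑ j ∈ Finset.Ico (6000 : ℕ) 7500, (legendreSym 67 (j : ℤ) * legendreSym 31 (j : ℤ)) * (j : ℤ) ^ (7 + 1) =
      -188854370793921744999376523635212 := by
  simp_rw [legendreSym_eq_ite 67 (by norm_num), legendreSym_eq_ite 31 (by norm_num)]
  decide +kernel

set_option maxRecDepth 400000 in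
/-- Block 5 of the `θ₂` certificate for `D = −67`: `Σ_{7500 ≤ j < 9000} (j/67)(j/31) j⁸` evaluated (`decide +kernel`). [folklore] -/
theorem theta2_D67_block5 :
    ∑ j ∈ Finset.Ico (7500 : ℕ) 9000, (legendreSym 67 (j : ℤ) * legendreSym 31 (j : ℤ)) * (j : ℤ) ^ (7 + 1) =
      1450947302459630130952611462001649 := by
  simp_rw [legendreSym_eq_ite 67 (by norm_num), legendreSym_eq_ite 31 (by norm_num)]
  decide +kernel

set_option maxRecDepth 400000 in
/-- Block 6 of the `θ₂` certificate for `D = −67`: `Σ_{9000 ≤ j < 10500} (j/67)(j/31) j⁸` evaluated (`decide +kernel`). [folklore] -/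
theorem theta2_D67_block6 :
    ∑ j ∈ Finset.Ico (9000 : ℕ) 10500, (legendreSym 67 (j : ℤ) * legendreSym 31 (j : ℤ)) * (j : ℤ) ^ (7 + 1) =
      -1734224638224853643955512501453446 := by
  simp_rw [legendreSym_eq_ite 67 (by norm_num), legendreSym_eq_ite 31 (by norm_num)]
  decide +kernel

set_option maxRecDepth 400000 in
/-- Block 7 of the `θ₂` certificate for `D = −67`: `Σ_{10500 ≤ j < 12000} (j/67)(j/31) j⁸` evaluated (`decide +kernel`). [folklore] -/
theorem theta2_D67_block7 :
    ∑ j ∈ Finset.Ico (10500 : ℕ) 12000, (legendreSym 67 (j : ℤ) * legendreSym 31 (j : ℤ)) * (j : ℤ) ^ (7 + 1) =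
      1272107986920688608451234710023285 := by
  simp_rw [legendreSym_eq_ite 67 (by norm_num), legendreSym_eq_ite 31 (by norm_num)]
  decide +kernel

set_option maxRecDepth 400000 in
/-- Block 8 of the `θ₂` certificate for `D = −67`: `Σ_{12000 ≤ j < 13500} (j/67)(j/31) j⁸` evaluated (`decide +kernel`). [folklore] -/
theorem theta2_D67_block8 :
    ∑ j ∈ Finset.Ico (12000 : ℕ) 13500, (legendreSym 67 (j : ℤ) * legendreSym 31 (j : ℤ)) * (j : ℤ) ^ (7 + 1) =
      -3626374407692110858405565034347975 := by
  simp_rw [legendreSym_eq_ite 67 (by norm_num), legendreSym_eq_ite 31 (by norm_num)]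
  decide +kernel

set_option maxRecDepth 400000 in
/-- Block 9 of the `θ₂` certificate for `D = −67`: `Σ_{13500 ≤ j < 14539} (j/67)(j/31) j⁸` evaluated (`decide +kernel`). [folklore] -/
theorem theta2_D67_block9 :
    ∑ j ∈ Finset.Ico (13500 : ℕ) (7 * 67 * 31), (legendreSym 67 (j : ℤ) * legendreSym 31 (j : ℤ)) * (j : ℤ) ^ (7 + 1) =
      7256474984945113598721503530308280 := by
  simp_rw [legendreSym_eq_ite 67 (by norm_num), legendreSym_eq_ite 31 (by norm_num)]
  decide +kernel

/-- The `θ₂` certificate sum for `D = −67` assembled from its blocks: `Σ_{j<14539} (j/67)(j/31) j⁸ = S₂` with `7 ∥ S₂`. [folklore] -/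
theorem theta2_D67_sum :
    ∑ j ∈ Finset.range (7 * 67 * 31), (legendreSym 67 (j : ℤ) * legendreSym 31 (j : ℤ)) * (j : ℤ) ^ (7 + 1) =
      4409735522282586378657187991329024 := by
  rw [Finset.range_eq_Ico, ← Finset.sum_Ico_consecutive _ (show 0 ≤ 1500 by norm_num) (show 1500 ≤ 7 * 67 * 31 by norm_num), ← Finset.sum_Ico_consecutive _ (show 1500 ≤ 3000 by norm_num) (show 3000 ≤ 7 * 67 * 31 by norm_num), ← Finset.sum_Ico_consecutive _ (show 3000 ≤ 4500 by norm_num) (show 4500 ≤ 7 * 67 * 31 by norm_num), ← Finset.sum_Ico_consecutive _ (show 4500 ≤ 6000 by norm_num) (show 6000 ≤ 7 * 67 * 31 by norm_num), ← Finset.sum_Ico_consecutive _ (show 6000 ≤ 7500 by norm_num) (show 7500 ≤ 7 * 67 * 31 by norm_num), ← Finset.sum_Ico_consecutive _ (show 7500 ≤ 9000 by norm_num) (show 9000 ≤ 7 * 67 * 31 by norm_num), ← Finset.sum_Ico_consecutive _ (show 9000 ≤ 10500 by norm_num) (show 10500 ≤ 7 * 67 * 31 by norm_num), ← Finset.sum_Ico_consecutive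 _ (show 10500 ≤ 12000 by norm_num) (show 12000 ≤ 7 * 67 * 31 by norm_num), ← Finset.sum_Ico_consecutive _ (show 12000 ≤ 13500 by norm_num) (show 13500 ≤ 7 * 67 * 31 by norm_num), theta2_D67_block0, theta2_D67_block1, theta2_D67_block2, theta2_D67_block3, theta2_D67_block4, theta2_D67_block5, theta2_D67_block6, theta2_D67_block7, theta2_D67_block8, theta2_D67_block9]
  norm_num

set_option maxRecDepth 400000 in
/-- **`‖B_{1,θ₂}‖₇ = 1`** for every character `θ₂` mod `7·67·31` with values `(j/67)·J(j | 31)·ω(j)`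
(certificate `7 ∥ Σ_{j<14539} (j/67)(j/31) j⁸`, `decide +kernel`).
[cite: KrizLi2019, Thm. 1.20 (p. 8) and §1.5 (1)] [cite: Washington1997, §5.1 and Thm. 4.2] -/
theorem norm_generalizedBernoulli_theta2_D67 (ω : DirichletCharacter ℚ_[7] 7)
    (hω : IsTeichmullerCharacter ω) (θ : DirichletCharacter ℚ_[7] (7 * 67 * 31))
    (hθ : ∀ j : ZMod (7 * 67 * 31), θ j =
      ((legendreSym 67 (j.val : ℤ) * jacobiSym (j.val : ℤ) 31 : ℤ) : ℚ_[7]) * ω (j.val : ZMod 7) ^ 1) :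
    ‖generalizedBernoulli 1 θ‖ = 1 := by
  have hθ' : ∀ j : ZMod (7 * 67 * 31), θ j =
      ((legendreSym 67 (j.val : ℤ) * legendreSym 31 (j.val : ℤ) : ℤ) : ℚ_[7]) * ω (j.val : ZMod 7) ^ 1 :=
    fun j => by rw [hθ j, ← jacobiSym.legendreSym.to_jacobiSym]
  have hθ1 : θ ≠ 1 := by
    intro h1
    have hv := hθ' (((14538 : ℕ)) : ZMod (7 * 67 * 31))
    have hval : (((14538 : ℕ) : ZMod (7 * 67 * 31))).val = 14538 := by
      rw [ZMod.val_natCast]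
    have hu : IsUnit (((14538 : ℕ)) : ZMod (7 * 67 * 31)) := by
      rw [ZMod.isUnit_iff_coprime]; norm_num
    rw [h1, hval, MulChar.one_apply hu, pow_one] at hv
    have hL : legendreSym 67 ((14538 : ℕ) : ℤ) * legendreSym 31 ((14538 : ℕ) : ℤ) = 1 := by
      rw [legendreSym_eq_ite 67 (by norm_num), legendreSym_eq_ite 31 (by norm_num)]; decide
    rw [hL, Int.cast_one, one_mul] at hv
    -- `ω(−1) = 1` contradicts `‖ω(6) − 6‖ < 1`
    have h6 : (((14538 : ℕ)) : ZMod 7) = ((6 : ℤ) : ZMod 7) := by decide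
    rw [h6] at hv
    have hT := hω 6 (by decide)
    rw [← hv] at hT
    have : ‖(1 : ℚ_[7]) - ((6 : ℤ) : ℚ_[7])‖ = 1 := by
      rw [show (1 : ℚ_[7]) - ((6 : ℤ) : ℚ_[7]) = -((5 : ℕ) : ℚ_[7]) by norm_num, norm_neg]
      exact Padic.norm_natCast_eq_one_iff.mpr (by decide)
    rw [this] at hT
    exact lt_irrefl _ hT
  refine norm_generalizedBernoulli_one_eq_one_of_cert_range θ hθ1 padicValNat_seven_level2_D67
    (fun j => legendreSym 67 (j : ℤ) * legendreSym 31 (j : ℤ)) 7 (fun j => ?_) 4409735522282586378657187991329024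
    theta2_D67_sum (by norm_num) (by norm_num)
  have := norm_sub_le_of_values ω hω θ (fun m => legendreSym 67 (m : ℤ) * legendreSym 31 (m : ℤ))
    1 le_rfl hθ' j
  simpa using this

/-- **ROUTE U, member `D = −67` (`219961e1`, `N = 49·67² = 219961`): BSD₇ for every globally minimal model of
`49a1^{(−67)}` with `r_an = 1`**, by the prime-member class theorem at `(q, r) = (67, 31)` with the two
certificates above; the descent inputs (no `7`-torsion over `K`, `7 ∤ #Ш(W)`) are discharged inside the
class theorem (Mazur's local step; Buhler–Gross 1985 Ch. II BY NAME, binder `hBG`).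
[cite: KrizLi2019, Thm. 1.20 and Rem. 3.10] [cite: Rubin1983, §0 Thm. C (p. 341)]
[cite: BurungaleFlach2024, Thm 1.1 and Cor. 2] [cite: GrossZagier1986, I.(6.5) and V.(2.1)]
[cite: Miller2011LMS, Thm. 2.5 and (5.1)] [cite: BuhlerGross1985, Ch. II (7.2)(2), (8.3)(1), (9.1) (pp. 16–18)] -/
theorem bsdp_seven_of_twist_cm7_D67
    (hKL : KrizLi2019.thm120_padicLogHeegner_unit_of_bernoulli)
    (hRem : KrizLi2019.rem310_padicLogHeegner_integral)
    (W : WeierstrassCurve ℚ) [W.IsElliptic] [W.IsGloballyMinimal] [NeZero (W.conductorNorm ℤ)]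
    (hW : ∃ C : VariableChange ℚ, C • W = cm7.quadraticTwist ((-(67 : ℕ) : ℤ) : ℚ))
    (K : Type) [Field K] [NumberField K] [NeZero (NumberField.discr K).natAbs]
    (hK : IsImaginaryQuadratic K) (hdK : NumberField.discr K = -(31 : ℕ))
    (D : ModularParametrizationData W (W.conductorNorm ℤ))
    (H : HeegnerDatum (W.conductorNorm ℤ) (NumberField.discr K)) (ι : K →+* ℂ) (ιp : K →+* ℚ_[7])
    (P : (W.baseChange K).toAffine.Point)
    (hGZ : gross_zagier (W.conductorNorm ℤ) W K) (hKo : kolyvagin (W.conductorNorm ℤ) W K)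
    (hGZK : rank_eq_analyticRank_of_analyticRank_le_one) (hmod : hasEntireLFunction_rat)
    (hP : WeierstrassCurve.Affine.Point.map ι.toRatAlgHom P = heegnerPointComplex D H)
    (hr1 : W.analyticRank = 1)
    (hLt : (W.quadraticTwist (NumberField.discr K : ℚ)).entireLFunction 1 ≠ 0)
    (Wd : WeierstrassCurve ℚ) [Wd.IsElliptic] [Wd.IsGloballyMinimal] (Cd : VariableChange ℚ)
    (hWd : Cd • W.quadraticTwist (NumberField.discr K : ℚ) = Wd)
    (hBF : bsdTriple_of_hasCM_of_L_one_ne_zero)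
    (hu : padicValRat 7 (Cd.u : ℚ) = 0)
    (hC : Rubin1983.thmC_seven_quadraticField)
    (hBG : BuhlerGross1985.firstDescent_seven_oddTwist_of_bernoulli)
    [Finite (AddCommGroup.torsion (W.baseChange K).toAffine.Point)]
    (crd : (W.baseChange K).toAffine.Point →+ ℤ) (g : (W.baseChange K).toAffine.Point)
    (hg : crd g = 1) (hker : ∀ x, crd x = 0 → IsOfFinAddOrder x)
    (hc7 : ¬ ((7 : ℤ) ∣ D.c)) :
    BSDp W 7 :=
  bsdp_seven_of_twist_cm7_prime (q := 67) (r := 31) (by norm_num) (by norm_num) (by norm_num)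
    (by norm_num) (by norm_num) (by norm_num)
    (by rw [legendreSym_eq_ite 7 (by norm_num)]; decide)
    (by rw [legendreSym_eq_ite 67 (by norm_num)]; decide)
    (norm_generalizedBernoulli_theta1_D67) (norm_generalizedBernoulli_theta2_D67)
    hKL hRem W hW K hK hdK D H ι ιp P hGZ hKo hGZK hmod hP hr1 hLt Wd Cd hWd hBF hu hC hBG crd g hg
    hker hc7


/-- **ROUTE U, member `D = −67` (`219961e1`): FULL BSD** (Miller's `BSD(E,p)` at EVERY prime) for every
globally minimal model of `49a1^{(−67)}` with `r_an = 1` (`W ∈ 𝒞₇` since `(−7/67) = 1`), by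
`forall_bsdp_of_twist_cm7_prime` at `(q, r) = (67, 31)`.
[cite: Miller2011LMS, §1 and Def. 1.1 (arXiv:1010.2431 p. 3)] [cite: KrizLi2019, Thm. 1.20 and Rem. 3.10] -/
theorem forall_bsdp_of_twist_cm7_D67
    (hKL : KrizLi2019.thm120_padicLogHeegner_unit_of_bernoulli)
    (hRem : KrizLi2019.rem310_padicLogHeegner_integral)
    (W : WeierstrassCurve ℚ) [W.IsElliptic] [W.IsGloballyMinimal] [NeZero (W.conductorNorm ℤ)]
    (hW : ∃ C : VariableChange ℚ, C • W = cm7.quadraticTwist ((-(67 : ℕ) : ℤ) : ℚ))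
    (K : Type) [Field K] [NumberField K] [NeZero (NumberField.discr K).natAbs]
    (hK : IsImaginaryQuadratic K) (hdK : NumberField.discr K = -(31 : ℕ))
    (D : ModularParametrizationData W (W.conductorNorm ℤ))
    (H : HeegnerDatum (W.conductorNorm ℤ) (NumberField.discr K)) (ι : K →+* ℂ) (ιp : K →+* ℚ_[7])
    (P : (W.baseChange K).toAffine.Point)
    (hGZ : gross_zagier (W.conductorNorm ℤ) W K) (hKo : kolyvagin (W.conductorNorm ℤ) W K)
    (hGZK : rank_eq_analyticRank_of_analyticRank_le_one) (hmod : hasEntireLFunction_rat)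
    (hP : WeierstrassCurve.Affine.Point.map ι.toRatAlgHom P = heegnerPointComplex D H)
    (hr1 : W.analyticRank = 1)
    (hLt : (W.quadraticTwist (NumberField.discr K : ℚ)).entireLFunction 1 ≠ 0)
    (Wd : WeierstrassCurve ℚ) [Wd.IsElliptic] [Wd.IsGloballyMinimal] (Cd : VariableChange ℚ)
    (hWd : Cd • W.quadraticTwist (NumberField.discr K : ℚ) = Wd)
    (hBF : bsdTriple_of_hasCM_of_L_one_ne_zero)
    (hu : padicValRat 7 (Cd.u : ℚ) = 0)
    (hC : Rubin1983.thmC_seven_quadraticField)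
    (hBG : BuhlerGross1985.firstDescent_seven_oddTwist_of_bernoulli)
    [Finite (AddCommGroup.torsion (W.baseChange K).toAffine.Point)]
    (crd : (W.baseChange K).toAffine.Point →+ ℤ) (g : (W.baseChange K).toAffine.Point)
    (hg : crd g = 1) (hker : ∀ x, crd x = 0 → IsOfFinAddOrder x)
    (hc7 : ¬ ((7 : ℤ) ∣ D.c)) (hLLT : LiLiuTian2024.thm11_bsdp_of_cm_rank_one)
    (hKob : Kobayashi2013.cor14_bsdp_of_cm_rank_one) (hLTYZ : LiTianYanZhu2025.thm11_bsdp_of_cm_rank_one) :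
    ∀ p : ℕ, p.Prime → BSDp W p :=
  forall_bsdp_of_twist_cm7_prime (q := 67) (r := 31) (by norm_num) (by norm_num) (by norm_num)
    (by norm_num) (by norm_num) (by norm_num)
    (by rw [legendreSym_eq_ite 7 (by norm_num)]; decide)
    (by rw [legendreSym_eq_ite 67 (by norm_num)]; decide)
    (by rw [legendreSym_eq_ite 67 (by norm_num)]; decide)
    (norm_generalizedBernoulli_theta1_D67) (norm_generalizedBernoulli_theta2_D67)
    hKL hRem W hW K hK hdK D H ι ιp P hGZ hKo hGZK hmod hP hr1 hLt Wd Cd hWd hBF hu hC hBG crd g hg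
    hker hc7 hLLT hKob hLTYZ


end Summit.BirchSwinnertonDyer.Rank1Residual.X12.O11.RouteU

end
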